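import Literature.NumberTheory.CubicFields.FundCubicFieldCountLandau
import HarnessLib

/-!
# BTT §5 for (3) with the WEAK Landau input: dyadic blocks bounded by `X^{2/3+ε}`

Topic `Literature/NumberTheory/CubicFields`; a variant of `FundCubicFieldCountLandau.lean`. There the analytic input
of Bhargava–Taniguchi–Thorne 2023, §5 was the hypothesis structure `LandauShintaniData s A`, whose field `landau` is
the dyadic consequence of Theorem 3.2 + Prop. 5.1: `Σ_{q∈[Q₁,2Q₁) sqfree} |N^s(X,Ψ_{q²}) − r₁(q)X − r₂(q)X^{5/6}|
≤ C X^{3/5+ε} Q₁^{1/5}` for `Q₁ ≤ X^{1/3−ε}`. The tree now PROVES Landau's method for the Shintani zeta functions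
in a Bessel-free weak form (`UniformLandauShintani.exists_landau_yform`), which on such a block yields only the flat
bound `≤ C X^{2/3+ε}` (the exponent `3/5` of [LDTT] needs the Bessel expansion of the kernel). Since §5 chooses
`Q = X^{1/3−ε}` and ends with `O(X^{2/3+ε})` anyway, the flat bound suffices: this file repeats the bookkeeping of
`FundCubicFieldCountLandau.lean` with

* `LandauShintaniDataWeak s A` — the same hypothesis structure with the flat dyadic field
  `landau : Σ_{block} ≤ C X^{2/3+ε}` (nothing asserted);
* `sum_dyadic_flat_le` — `E₂`: the `≤ 1 + log₂ X^{1/3}` blocks cost a factor `2X^δ/(2^δ − 1)`;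
* `abs_sum_moebius_nonFundCount_sub_le_weak`, **`btt_fundCubicFieldCount_sum_of_landauShintaniWeak`** — the core of
  §5 and (3) = `btt_fundCubicFieldCount_sum` from the weak input (both signs, `A = 3/π², 2/π²`) and
  `btt_uniformity_sqDvd`, verbatim as in `FundCubicFieldCountLandau.lean` except for `E₂`.

## References

* M. Bhargava, T. Taniguchi, F. Thorne, *Improved error estimates for the Davenport–Heilbronn theorems*,
  Math. Ann. 389 (2024) = arXiv:2107.12819, §5 ((20), (21), `E₁, E₂, E₃`, `Q = X^{1/3−ε}`). [BhargavaTaniguchiThorne2023]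
-/

noncomputable section

open Finset ArithmeticFunction
open scoped ArithmeticFunction.Moebius

namespace Literature.NumberTheory.CubicFields

open BinaryCubic RingOfForm Literature.NumberTheory.QuadraticFields Classical

/-! ### The weak analytic input -/

/-- **The Landau–Shintani input of BTT §5 for `Ψ_{q²}`, sign `s`, main constant `A`, WEAK form** — a HYPOTHESIS
STRUCTURE as `LandauShintaniData`, with the dyadic Landau field weakened to the flat
`Σ_{q ∈ [Q₁, 2Q₁) sqfree} |N^s(X, Ψ_{q²}) − r₁(q) X − r₂(q) X^{5/6}| ≤ C_ε X^{2/3+ε}` for `1 ≤ Q₁ ≤ X^{1/3−ε}`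
(what the tree's Bessel-free Landau method gives; see `FundCubicFieldCountShintaniWeak.lean`).
[cite: BhargavaTaniguchiThorne2023, §5 (E₂ paragraph: Thm 3.2 + Prop. 5.1 on dyadic blocks Q₁ ≤ Q = X^{1/3−ε})] -/
structure LandauShintaniDataWeak (s : ℤ) (A : ℝ) where
  /-- `r₁(q) = Res_{s=1} ξ^{sgn}(s, Ψ_{q²})`. -/
  r₁ : ℕ → ℝ
  /-- `r₂(q) = (6/5) Res_{s=5/6} ξ^{sgn}(s, Ψ_{q²})`. -/
  r₂ : ℕ → ℝ
  /-- `r₁(q) ≪_η q^{-2+η}` on squarefree `q`. -/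
  abs_r₁_le : ∀ η : ℝ, 0 < η → ∃ C₁ : ℝ, ∀ q : ℕ, Squarefree q → |r₁ q| ≤ C₁ * (q : ℝ) ^ (-2 + η)
  /-- `Σ_q μ(q) r₁(q) = A` ((21)). -/
  hasSum_moebius_mul_r₁ : HasSum (fun q : ℕ => ((μ q : ℤ) : ℝ) * r₁ q) A
  /-- `r₂(q) ≪_η q^{-5/3+η}` on squarefree `q`. -/
  abs_r₂_le : ∀ η : ℝ, 0 < η → ∃ C₂ : ℝ, ∀ q : ℕ, Squarefree q → |r₂ q| ≤ C₂ * (q : ℝ) ^ (-(5 : ℝ) / 3 + η)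
  /-- The flat dyadic Landau bound on `[Q₁, 2Q₁)`, `Q₁ ≤ X^{1/3−ε}`. -/
  landau : ∀ ε : ℝ, 0 < ε → ∃ C : ℝ, ∀ X : ℕ, 1 ≤ X → ∀ Q₁ : ℕ, 1 ≤ Q₁ → (Q₁ : ℝ) ≤ (X : ℝ) ^ ((1 : ℝ) / 3 - ε) →
    ∑ q ∈ (Finset.Ico Q₁ (2 * Q₁)).filter Squarefree,
        |nonFundCount s q X - r₁ q * X - r₂ q * (X : ℝ) ^ ((5 : ℝ) / 6)|
      ≤ C * (X : ℝ) ^ ((2 : ℝ) / 3 + ε)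

/-! ### `E₂` with the flat block bound -/

/-- The number of dyadic blocks: `J + 1 ≤ 2X^δ/(2^δ − 1)` when `2^J ≤ X^{1/3−δ}`, `0 < δ ≤ 1`, `X ≥ 1`
(`J + 1 ≤ Σ_{j≤J} 2^{jδ} ≤ 2^{(J+1)δ}/(2^δ − 1)`). [folklore] -/
theorem succ_le_mul_rpow_of_two_pow_le {X δ : ℝ} (hX : 1 ≤ X) (hδ0 : 0 < δ) (hδ1 : δ ≤ 1) {J : ℕ}
    (hJ : ((2 : ℝ) ^ J) ≤ X ^ ((1 : ℝ) / 3 - δ)) : ((J : ℝ) + 1) ≤ 2 / ((2 : ℝ) ^ δ - 1) * X ^ δ := by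
  have hX0 : 0 < X := by linarith
  set r : ℝ := (2 : ℝ) ^ δ with hr
  have hr1 : 1 < r := Real.one_lt_rpow (by norm_num) hδ0
  have hr0 : 0 < r := by linarith
  have hr2 : r ≤ 2 := by
    calc r = (2 : ℝ) ^ δ := rfl
      _ ≤ (2 : ℝ) ^ (1 : ℝ) := Real.rpow_le_rpow_of_exponent_le (by norm_num) hδ1
      _ = 2 := Real.rpow_one 2
  -- `J + 1 ≤ Σ_{j ≤ J} r^j = (r^{J+1} − 1)/(r − 1)`
  have hcount : ((J : ℝ) + 1) ≤ ∑ j ∈ Finset.range (J + 1), r ^ j := by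
    have h : ∀ j ∈ Finset.range (J + 1), (1 : ℝ) ≤ r ^ j := fun j _ => one_le_pow₀ hr1.le
    calc ((J : ℝ) + 1) = ∑ _j ∈ Finset.range (J + 1), (1 : ℝ) := by simp
      _ ≤ ∑ j ∈ Finset.range (J + 1), r ^ j := Finset.sum_le_sum h
  have hgeom : ∑ j ∈ Finset.range (J + 1), r ^ j = (r ^ (J + 1) - 1) / (r - 1) := geom_sum_eq hr1.ne' _
  -- `r^J = (2^J)^δ ≤ X^δ`
  have hrJ : r ^ J ≤ X ^ δ := by
    have e : r ^ J = ((2 : ℝ) ^ J) ^ δ := by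
      rw [hr, ← Real.rpow_natCast, ← Real.rpow_mul (by norm_num), mul_comm, Real.rpow_mul (by norm_num),
        Real.rpow_natCast]
    rw [e]
    calc ((2 : ℝ) ^ J) ^ δ ≤ (X ^ ((1 : ℝ) / 3 - δ)) ^ δ := Real.rpow_le_rpow (by positivity) hJ hδ0.le
      _ = X ^ (((1 : ℝ) / 3 - δ) * δ) := by rw [← Real.rpow_mul hX0.le]
      _ ≤ X ^ δ := Real.rpow_le_rpow_of_exponent_le hX (by nlinarith)
  calc ((J : ℝ) + 1) ≤ (r ^ (J + 1) - 1) / (r - 1) := hgeom ▸ hcount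
    _ ≤ r ^ (J + 1) / (r - 1) := div_le_div_of_nonneg_right (by linarith) (by linarith)
    _ = r * r ^ J / (r - 1) := by rw [pow_succ]; ring
    _ ≤ 2 * X ^ δ / (r - 1) := by
        refine div_le_div_of_nonneg_right ?_ (by linarith)
        exact mul_le_mul hr2 hrJ (by positivity) (by norm_num)
    _ = 2 / (r - 1) * X ^ δ := by ring

/-- **`E₂` from the flat block bound**: `Σ_{q < 2^{J+1} sqfree} |N − r₁X − r₂X^{5/6}| ≤ (2/(2^δ−1)) C X^{2/3+2δ}` when
each block `[2^j, 2^{j+1})`, `j ≤ J`, `2^J ≤ X^{1/3−δ}`, is `≤ C X^{2/3+δ}`. [cite: BhargavaTaniguchiThorne2023, §5 (E₂ summed over the dyadic blocks Q₁ ≤ Q)] -/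
theorem sum_dyadic_flat_le {s : ℤ} {r₁ r₂ : ℕ → ℝ} {C δ : ℝ} (hC : 0 ≤ C) (hδ0 : 0 < δ) (hδ1 : δ ≤ 1)
    (hLan : ∀ X : ℕ, 1 ≤ X → ∀ Q₁ : ℕ, 1 ≤ Q₁ → (Q₁ : ℝ) ≤ (X : ℝ) ^ ((1 : ℝ) / 3 - δ) →
      ∑ q ∈ (Finset.Ico Q₁ (2 * Q₁)).filter Squarefree,
          |nonFundCount s q X - r₁ q * X - r₂ q * (X : ℝ) ^ ((5 : ℝ) / 6)|
        ≤ C * (X : ℝ) ^ ((2 : ℝ) / 3 + δ))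
    {X : ℕ} (hX : 1 ≤ X) {J : ℕ} (hJ : ((2 : ℝ) ^ J) ≤ (X : ℝ) ^ ((1 : ℝ) / 3 - δ)) :
    ∑ q ∈ (Finset.Ico 1 (2 ^ (J + 1))).filter Squarefree,
        |nonFundCount s q X - r₁ q * X - r₂ q * (X : ℝ) ^ ((5 : ℝ) / 6)|
      ≤ 2 / ((2 : ℝ) ^ δ - 1) * C * (X : ℝ) ^ ((2 : ℝ) / 3 + 2 * δ) := by
  have hX1 : (1 : ℝ) ≤ X := by exact_mod_cast hX
  have hX0 : (0 : ℝ) < X := by linarith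
  rw [Finset.sum_filter, sum_Ico_one_two_pow_eq_sum_range]
  have hJ1 := succ_le_mul_rpow_of_two_pow_le hX1 hδ0 hδ1 hJ
  have h2δ : (1 : ℝ) < (2 : ℝ) ^ δ := Real.one_lt_rpow (by norm_num) hδ0
  calc ∑ j ∈ Finset.range (J + 1), ∑ q ∈ Finset.Ico (2 ^ j) (2 ^ (j + 1)),
        (if Squarefree q then |nonFundCount s q X - r₁ q * X - r₂ q * (X : ℝ) ^ ((5 : ℝ) / 6)| else 0)
      ≤ ∑ _j ∈ Finset.range (J + 1), C * (X : ℝ) ^ ((2 : ℝ) / 3 + δ) := by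
        refine Finset.sum_le_sum fun j hj => ?_
        rw [← Finset.sum_filter, pow_succ, mul_comm (2 ^ j) 2]
        have hjJ : j ≤ J := Nat.lt_succ_iff.mp (Finset.mem_range.mp hj)
        have h2j : ((2 ^ j : ℕ) : ℝ) ≤ (X : ℝ) ^ ((1 : ℝ) / 3 - δ) := by
          push_cast
          exact le_trans (pow_le_pow_right₀ (by norm_num) hjJ) hJ
        exact hLan X hX (2 ^ j) Nat.one_le_two_pow h2j
    _ = ((J : ℝ) + 1) * (C * (X : ℝ) ^ ((2 : ℝ) / 3 + δ)) := by
        rw [Finset.sum_const, Finset.card_range, nsmul_eq_mul]; push_cast; ring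
    _ ≤ (2 / ((2 : ℝ) ^ δ - 1) * (X : ℝ) ^ δ) * (C * (X : ℝ) ^ ((2 : ℝ) / 3 + δ)) :=
        mul_le_mul_of_nonneg_right hJ1 (by positivity)
    _ = 2 / ((2 : ℝ) ^ δ - 1) * C * ((X : ℝ) ^ ((2 : ℝ) / 3 + δ) * (X : ℝ) ^ δ) := by ring
    _ = 2 / ((2 : ℝ) ^ δ - 1) * C * (X : ℝ) ^ ((2 : ℝ) / 3 + 2 * δ) := by
        rw [← Real.rpow_add hX0]; ring_nf

/-! ### The core of §5 with the weak input -/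

/-- **BTT §5, the direct proof, as bookkeeping — weak Landau input**: `LandauShintaniDataWeak s A` and
`btt_uniformity_sqDvd` give `K = Σ_q μ(q) r₂(q)` with `|Σ_{q ≤ X} μ(q) N^s(X, Ψ_{q²}) − A X − K X^{5/6}| ≤ C_ε X^{2/3+ε}`
for all `X ≥ 1` (the proof of `abs_sum_moebius_nonFundCount_sub_le` verbatim, except that `E₂` is summed with
`sum_dyadic_flat_le`). [cite: BhargavaTaniguchiThorne2023, §5 (displays (20)–(21) and the estimates of E₁, E₂, E₃ with Q = X^{1/3−ε})] -/
theorem abs_sum_moebius_nonFundCount_sub_le_weak {s : ℤ} (hs : s = 1 ∨ s = -1) {A : ℝ}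
    (hL : LandauShintaniDataWeak s A) (hU : btt_uniformity_sqDvd) :
    ∃ K : ℝ, ∀ ε : ℝ, 0 < ε → ∃ C : ℝ, ∀ X : ℕ, 1 ≤ X →
      |(∑ q ∈ Finset.Icc 1 X, ((μ q : ℤ) : ℝ) * nonFundCount s q X) - A * X - K * (X : ℝ) ^ ((5 : ℝ) / 6)|
        ≤ C * (X : ℝ) ^ ((2 : ℝ) / 3 + ε) := by
  obtain ⟨r₁, r₂, hR1, hSum, hR2, hLan⟩ := hL
  refine ⟨∑' q, ((μ q : ℤ) : ℝ) * r₂ q, fun ε hε => ?_⟩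
  -- the working exponent `δ`: `2δ ≤ ε`, `δ ≤ 1/30`
  set δ : ℝ := min ε (1 / 15) / 2 with hδ
  have hδ0 : 0 < δ := by rw [hδ]; positivity
  have hδε : 2 * δ ≤ ε := by rw [hδ]; linarith [min_le_left ε (1 / 15)]
  have hδ30 : δ ≤ 1 / 30 := by rw [hδ]; linarith [min_le_right ε (1 / 15)]
  -- constants
  obtain ⟨C₁', hC₁'⟩ := hR1 δ hδ0
  obtain ⟨C₂', hC₂'⟩ := hR2 δ hδ0
  obtain ⟨C_L', hC_L'⟩ := hLan δ hδ0
  obtain ⟨C_U', hC_U'⟩ := exists_nonFundCount_le hU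
  obtain ⟨C₆, hC₆0, hC₆⟩ := pow_card_primeFactors_le (by norm_num : (1 : ℝ) ≤ 6) hδ0
  set C₁ := max C₁' 0 with hC₁
  set C₂ := max C₂' 0 with hC₂
  set C_L := max C_L' 0 with hCL
  set C_U := max C_U' 0 with hCU
  have hC₁r : ∀ q : ℕ, Squarefree q → |r₁ q| ≤ C₁ * (q : ℝ) ^ (-(2 - δ)) := fun q hq =>
    (hC₁' q hq).trans (by rw [show -(2 - δ) = -2 + δ by ring]; gcongr; exact le_max_left _ _)
  have hC₂r : ∀ q : ℕ, Squarefree q → |r₂ q| ≤ C₂ * (q : ℝ) ^ (-(5 / 3 - δ)) := fun q hq =>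
    (hC₂' q hq).trans (by rw [show -((5 : ℝ) / 3 - δ) = -(5 : ℝ) / 3 + δ by ring]; gcongr; exact le_max_left _ _)
  have hCLr : ∀ X : ℕ, 1 ≤ X → ∀ Q₁ : ℕ, 1 ≤ Q₁ → (Q₁ : ℝ) ≤ (X : ℝ) ^ ((1 : ℝ) / 3 - δ) →
      ∑ q ∈ (Finset.Ico Q₁ (2 * Q₁)).filter Squarefree,
          |nonFundCount s q X - r₁ q * X - r₂ q * (X : ℝ) ^ ((5 : ℝ) / 6)|
        ≤ C_L * (X : ℝ) ^ ((2 : ℝ) / 3 + δ) := fun X hX Q₁ hQ₁ hQ =>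
    (hC_L' X hX Q₁ hQ₁ hQ).trans (by gcongr; exact le_max_left _ _)
  set K₂ : ℝ := 2 / ((2 : ℝ) ^ δ - 1) with hK₂
  have h2δ : (1 : ℝ) < (2 : ℝ) ^ δ := Real.one_lt_rpow (by norm_num) hδ0
  have hK₂0 : 0 ≤ K₂ := by rw [hK₂]; exact div_nonneg (by norm_num) (by linarith)
  have hCUr : ∀ q : ℕ, Squarefree q → ∀ X : ℕ, nonFundCount s q X ≤ C_U * 6 ^ q.primeFactors.card * X / (q : ℝ) ^ 2 :=
    fun q hq X => (hC_U' q hq s hs X).trans (by gcongr; exact le_max_left _ _)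
  refine ⟨K₂ * C_L + 4 * C₁ + 3 * C₂ + 4 * C_U * C₆, fun X hX => ?_⟩
  have hX1 : (1 : ℝ) ≤ X := by exact_mod_cast hX
  have hX0 : (0 : ℝ) < X := by positivity
  -- `Q = 2^J ≤ Y = X^{1/3-δ} < 2^{J+1} = M`
  set Y : ℝ := (X : ℝ) ^ ((1 : ℝ) / 3 - δ) with hY
  have hY1 : 1 ≤ Y := Real.one_le_rpow hX1 (by linarith)
  have hY0 : 0 < Y := by linarith
  obtain ⟨J, hJY, hYJ⟩ := exists_two_pow_le_lt hY1
  set M : ℕ := 2 ^ (J + 1) with hM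
  have hMY : Y ≤ (M : ℝ) := by rw [hM]; push_cast; exact hYJ.le
  have hM1 : 1 ≤ M := Nat.one_le_two_pow
  have hM0 : (0 : ℝ) < M := by positivity
  have hQM : 2 ^ J < M := by rw [hM]; exact Nat.pow_lt_pow_right (by norm_num) (by omega)
  -- abbreviations
  set N : ℕ → ℝ := fun q => nonFundCount s q X with hN
  set m : ℕ → ℝ := fun q => ((μ q : ℤ) : ℝ) with hm
  -- Step 0: `Σ_{q ≤ X} = Σ_{q < M} + Σ_{M ≤ q ≤ X}` (terms `q > X` vanish)
  have hsplit : ∑ q ∈ Finset.Icc 1 X, m q * N q =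
      ∑ q ∈ Finset.Ico 1 M, m q * N q + ∑ q ∈ Finset.Icc 1 X \ Finset.Ico 1 M, m q * N q := by
    have h := Finset.sum_sdiff_sub_sum_sdiff (s₁ := Finset.Icc 1 X) (s₂ := Finset.Ico 1 M) (f := fun q => m q * N q)
    have hzero : ∑ q ∈ Finset.Ico 1 M \ Finset.Icc 1 X, m q * N q = 0 := by
      refine Finset.sum_eq_zero fun q hq => ?_
      rw [Finset.mem_sdiff, Finset.mem_Ico, Finset.mem_Icc] at hq
      exact moebius_mul_nonFundCount_eq_zero_of_lt hs (by omega)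
    rw [hzero] at h
    linarith
  -- Step 5 (`E₃`): the tail `M ≤ q ≤ X`
  have hE3 : |∑ q ∈ Finset.Icc 1 X \ Finset.Ico 1 M, m q * N q| ≤ 4 * C_U * C₆ * (X : ℝ) ^ ((2 : ℝ) / 3 + 2 * δ) := by
    have hsub : Finset.Icc 1 X \ Finset.Ico 1 M ⊆ Finset.Icc M X := by
      intro q hq
      rw [Finset.mem_sdiff, Finset.mem_Icc, Finset.mem_Ico] at hq
      rw [Finset.mem_Icc]; omega
    calc |∑ q ∈ Finset.Icc 1 X \ Finset.Ico 1 M, m q * N q|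
        ≤ ∑ q ∈ Finset.Icc 1 X \ Finset.Ico 1 M, |m q * N q| := Finset.abs_sum_le_sum_abs _ _
      _ ≤ ∑ q ∈ Finset.Icc M X, |m q * N q| := Finset.sum_le_sum_of_subset_of_nonneg hsub fun _ _ _ => abs_nonneg _
      _ ≤ C_U * C₆ * X * ∑ q ∈ Finset.Ioc (2 ^ J) X, (q : ℝ) ^ (-(2 - δ)) :=
          sum_Icc_abs_moebius_nonFundCount_le (le_max_right _ _) hCUr hC₆ hQM X
      _ ≤ C_U * C₆ * X * (((2 ^ J : ℕ) : ℝ) ^ (1 - (2 - δ)) / ((2 - δ) - 1)) := by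
          refine mul_le_mul_of_nonneg_left (Sieve.GPY.sum_Ioc_rpow_neg_le Nat.one_le_two_pow (by linarith)) ?_
          exact mul_nonneg (mul_nonneg (le_max_right _ _) hC₆0.le) hX0.le
      _ ≤ C_U * C₆ * X * (2 * (2 * (M : ℝ) ^ (1 - (2 - δ)))) := by
          refine mul_le_mul_of_nonneg_left ?_ (mul_nonneg (mul_nonneg (le_max_right _ _) hC₆0.le) hX0.le)
          rw [div_eq_mul_inv]
          have hinv : ((2 - δ) - 1)⁻¹ ≤ (2 : ℝ) := by
            rw [inv_le_comm₀ (by linarith) (by norm_num)]; linarith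
          have hQ : ((2 ^ J : ℕ) : ℝ) ^ (1 - (2 - δ)) ≤ 2 * (M : ℝ) ^ (1 - (2 - δ)) := by
            have h2Q : (M : ℝ) = 2 * ((2 ^ J : ℕ) : ℝ) := by rw [hM]; push_cast; ring
            rw [h2Q, Real.mul_rpow (by norm_num) (by positivity)]
            have h2 : (1 : ℝ) ≤ 2 * (2 : ℝ) ^ (1 - (2 - δ)) := by
              rw [show (1 : ℝ) - (2 - δ) = δ - 1 by ring, Real.rpow_sub (by norm_num : (0:ℝ) < 2), Real.rpow_one]
              rw [mul_div_assoc', le_div_iff₀ (by norm_num : (0:ℝ) < 2)]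
              have : (1 : ℝ) ≤ (2 : ℝ) ^ δ := Real.one_le_rpow (by norm_num) hδ0.le
              linarith
            calc ((2 ^ J : ℕ) : ℝ) ^ (1 - (2 - δ)) = 1 * ((2 ^ J : ℕ) : ℝ) ^ (1 - (2 - δ)) := (one_mul _).symm
              _ ≤ (2 * (2 : ℝ) ^ (1 - (2 - δ))) * ((2 ^ J : ℕ) : ℝ) ^ (1 - (2 - δ)) :=
                  mul_le_mul_of_nonneg_right h2 (by positivity)
              _ = 2 * ((2 : ℝ) ^ (1 - (2 - δ)) * ((2 ^ J : ℕ) : ℝ) ^ (1 - (2 - δ))) := by ring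
          calc ((2 ^ J : ℕ) : ℝ) ^ (1 - (2 - δ)) * ((2 - δ) - 1)⁻¹ ≤ (2 * (M : ℝ) ^ (1 - (2 - δ))) * 2 :=
                mul_le_mul hQ hinv (inv_nonneg.mpr (by linarith)) (by positivity)
            _ = 2 * (2 * (M : ℝ) ^ (1 - (2 - δ))) := by ring
      _ = 4 * C_U * C₆ * (X * (M : ℝ) ^ (1 - (2 - δ))) := by ring
      _ ≤ 4 * C_U * C₆ * (X : ℝ) ^ ((2 : ℝ) / 3 + 2 * δ) := by
          refine mul_le_mul_of_nonneg_left (mul_rpow_neg_le_of_le hX1 hδ0.le hδ30 hMY) ?_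
          exact mul_nonneg (mul_nonneg (by norm_num) (le_max_right _ _)) hC₆0.le
  -- Step 2 (`E₂`): the Landau error on `q < M`
  have hE2 : |∑ q ∈ Finset.Ico 1 M, m q * (N q - r₁ q * X - r₂ q * (X : ℝ) ^ ((5 : ℝ) / 6))|
      ≤ K₂ * C_L * (X : ℝ) ^ ((2 : ℝ) / 3 + 2 * δ) := by
    calc |∑ q ∈ Finset.Ico 1 M, m q * (N q - r₁ q * X - r₂ q * (X : ℝ) ^ ((5 : ℝ) / 6))|
        ≤ ∑ q ∈ Finset.Ico 1 M, |m q * (N q - r₁ q * X - r₂ q * (X : ℝ) ^ ((5 : ℝ) / 6))| := Finset.abs_sum_le_sum_abs _ _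
      _ ≤ ∑ q ∈ (Finset.Ico 1 M).filter Squarefree, |N q - r₁ q * X - r₂ q * (X : ℝ) ^ ((5 : ℝ) / 6)| := by
          rw [Finset.sum_filter]
          refine Finset.sum_le_sum fun q _ => ?_
          split_ifs with hq
          · rw [abs_mul]
            have hm1 : |m q| ≤ 1 := by
              show |((μ q : ℤ) : ℝ)| ≤ 1
              exact_mod_cast ArithmeticFunction.abs_moebius_le_one
            calc |m q| * _ ≤ 1 * _ := mul_le_mul_of_nonneg_right hm1 (abs_nonneg _)
              _ = _ := one_mul _
          · rw [hm]; simp only [ArithmeticFunction.moebius_eq_zero_of_not_squarefree hq, Int.cast_zero, zero_mul, abs_zero]; rfl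
      _ ≤ K₂ * C_L * (X : ℝ) ^ ((2 : ℝ) / 3 + 2 * δ) :=
          sum_dyadic_flat_le (le_max_right _ _) hδ0 (by linarith) hCLr hX hJY
  -- Steps 3–4 (`E₁`): completing the residue sums
  have hE1a : |(X : ℝ) * ∑ q ∈ Finset.Ico 1 M, m q * r₁ q - A * X| ≤ 4 * C₁ * (X : ℝ) ^ ((2 : ℝ) / 3 + 2 * δ) := by
    have h := abs_sum_Ico_moebius_mul_sub_tsum_le (a := 2 - δ) (by linarith) (le_max_right _ _) hC₁r hM1
    rw [hSum.tsum_eq] at h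
    calc |(X : ℝ) * ∑ q ∈ Finset.Ico 1 M, m q * r₁ q - A * X|
        = X * |∑ q ∈ Finset.Ico 1 M, m q * r₁ q - A| := by
          rw [← abs_of_pos hX0, ← abs_mul, abs_of_pos hX0]; ring_nf
      _ ≤ X * (C₁ * ((2 - δ) / ((2 - δ) - 1)) * (M : ℝ) ^ (1 - (2 - δ))) := mul_le_mul_of_nonneg_left h hX0.le
      _ ≤ X * (C₁ * 4 * (M : ℝ) ^ (1 - (2 - δ))) := by
          refine mul_le_mul_of_nonneg_left (mul_le_mul_of_nonneg_right ?_ (by positivity)) hX0.le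
          refine mul_le_mul_of_nonneg_left ?_ (le_max_right _ _)
          rw [div_le_iff₀ (by linarith)]; linarith
      _ = 4 * C₁ * (X * (M : ℝ) ^ (1 - (2 - δ))) := by ring
      _ ≤ 4 * C₁ * (X : ℝ) ^ ((2 : ℝ) / 3 + 2 * δ) :=
          mul_le_mul_of_nonneg_left (mul_rpow_neg_le_of_le hX1 hδ0.le hδ30 hMY) (mul_nonneg (by norm_num) (le_max_right _ _))
  have hE1b : |(X : ℝ) ^ ((5 : ℝ) / 6) * ∑ q ∈ Finset.Ico 1 M, m q * r₂ q - (∑' q, m q * r₂ q) * (X : ℝ) ^ ((5 : ℝ) / 6)|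
      ≤ 3 * C₂ * (X : ℝ) ^ ((2 : ℝ) / 3 + 2 * δ) := by
    have h := abs_sum_Ico_moebius_mul_sub_tsum_le (a := 5 / 3 - δ) (by linarith) (le_max_right _ _) hC₂r hM1
    have hX56 : (0 : ℝ) < (X : ℝ) ^ ((5 : ℝ) / 6) := by positivity
    calc |(X : ℝ) ^ ((5 : ℝ) / 6) * ∑ q ∈ Finset.Ico 1 M, m q * r₂ q - (∑' q, m q * r₂ q) * (X : ℝ) ^ ((5 : ℝ) / 6)|
        = (X : ℝ) ^ ((5 : ℝ) / 6) * |∑ q ∈ Finset.Ico 1 M, m q * r₂ q - ∑' q, m q * r₂ q| := by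
          rw [← abs_of_pos hX56, ← abs_mul, abs_of_pos hX56]; ring_nf
      _ ≤ (X : ℝ) ^ ((5 : ℝ) / 6) * (C₂ * ((5 / 3 - δ) / ((5 / 3 - δ) - 1)) * (M : ℝ) ^ (1 - (5 / 3 - δ))) :=
          mul_le_mul_of_nonneg_left h hX56.le
      _ ≤ (X : ℝ) ^ ((5 : ℝ) / 6) * (C₂ * 3 * (M : ℝ) ^ (1 - (5 / 3 - δ))) := by
          refine mul_le_mul_of_nonneg_left (mul_le_mul_of_nonneg_right ?_ (by positivity)) hX56.le
          refine mul_le_mul_of_nonneg_left ?_ (le_max_right _ _)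
          rw [div_le_iff₀ (by linarith)]; linarith
      _ = 3 * C₂ * ((X : ℝ) ^ ((5 : ℝ) / 6) * (M : ℝ) ^ (1 - (5 / 3 - δ))) := by ring
      _ ≤ 3 * C₂ * (X : ℝ) ^ ((2 : ℝ) / 3 + 2 * δ) :=
          mul_le_mul_of_nonneg_left (rpow_mul_rpow_neg_le_of_le hX1 hδ0.le hδ30 hMY) (mul_nonneg (by norm_num) (le_max_right _ _))
  -- assembly
  have hdecomp : (∑ q ∈ Finset.Icc 1 X, m q * N q) - A * X - (∑' q, m q * r₂ q) * (X : ℝ) ^ ((5 : ℝ) / 6) =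
      (∑ q ∈ Finset.Ico 1 M, m q * (N q - r₁ q * X - r₂ q * (X : ℝ) ^ ((5 : ℝ) / 6))) +
      ((X : ℝ) * ∑ q ∈ Finset.Ico 1 M, m q * r₁ q - A * X) +
      ((X : ℝ) ^ ((5 : ℝ) / 6) * ∑ q ∈ Finset.Ico 1 M, m q * r₂ q - (∑' q, m q * r₂ q) * (X : ℝ) ^ ((5 : ℝ) / 6)) +
      ∑ q ∈ Finset.Icc 1 X \ Finset.Ico 1 M, m q * N q := by
    rw [hsplit]
    simp only [mul_sub, Finset.sum_sub_distrib, Finset.mul_sum]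
    ring_nf
  have hXe : (X : ℝ) ^ ((2 : ℝ) / 3 + 2 * δ) ≤ (X : ℝ) ^ ((2 : ℝ) / 3 + ε) :=
    Real.rpow_le_rpow_of_exponent_le hX1 (by linarith)
  have hconst : 0 ≤ K₂ * C_L + 4 * C₁ + 3 * C₂ + 4 * C_U * C₆ := by
    have := le_max_right C_L' 0; have := le_max_right C₁' 0; have := le_max_right C₂' 0; have := le_max_right C_U' 0
    positivity
  calc |(∑ q ∈ Finset.Icc 1 X, m q * N q) - A * X - (∑' q, m q * r₂ q) * (X : ℝ) ^ ((5 : ℝ) / 6)|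
      ≤ |∑ q ∈ Finset.Ico 1 M, m q * (N q - r₁ q * X - r₂ q * (X : ℝ) ^ ((5 : ℝ) / 6))| +
        |(X : ℝ) * ∑ q ∈ Finset.Ico 1 M, m q * r₁ q - A * X| +
        |(X : ℝ) ^ ((5 : ℝ) / 6) * ∑ q ∈ Finset.Ico 1 M, m q * r₂ q - (∑' q, m q * r₂ q) * (X : ℝ) ^ ((5 : ℝ) / 6)| +
        |∑ q ∈ Finset.Icc 1 X \ Finset.Ico 1 M, m q * N q| := by
          rw [hdecomp]
          exact (abs_add_le _ _).trans (add_le_add ((abs_add_le _ _).trans (add_le_add (abs_add_le _ _) le_rfl)) le_rfl)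
    _ ≤ K₂ * C_L * (X : ℝ) ^ ((2 : ℝ) / 3 + 2 * δ) + 4 * C₁ * (X : ℝ) ^ ((2 : ℝ) / 3 + 2 * δ) +
        3 * C₂ * (X : ℝ) ^ ((2 : ℝ) / 3 + 2 * δ) + 4 * C_U * C₆ * (X : ℝ) ^ ((2 : ℝ) / 3 + 2 * δ) :=
          add_le_add (add_le_add (add_le_add hE2 hE1a) hE1b) hE3
    _ = (K₂ * C_L + 4 * C₁ + 3 * C₂ + 4 * C_U * C₆) * (X : ℝ) ^ ((2 : ℝ) / 3 + 2 * δ) := by ring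
    _ ≤ (K₂ * C_L + 4 * C₁ + 3 * C₂ + 4 * C_U * C₆) * (X : ℝ) ^ ((2 : ℝ) / 3 + ε) :=
          mul_le_mul_of_nonneg_left hXe hconst

/-! ### (3) from the weak analytic input and the uniformity estimate -/

/-- **BTT (3) ⟸ the weak Landau–Shintani input (both signs) + the uniformity estimate** (the proof of
`btt_fundCubicFieldCount_sum_of_landauShintani` verbatim on the weak core bound).
[cite: BhargavaTaniguchiThorne2023, §5 ("we obtain error terms of O(X^{2/3+ε}) … in (3), which is equivalent to Theorem 1.2")] -/
theorem btt_fundCubicFieldCount_sum_of_landauShintaniWeak (hneg : LandauShintaniDataWeak (-1) (3 / Real.pi ^ 2))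
    (hpos : LandauShintaniDataWeak 1 (2 / Real.pi ^ 2)) (hU : btt_uniformity_sqDvd) : btt_fundCubicFieldCount_sum := by
  constructor
  · obtain ⟨K, hK⟩ := abs_sum_moebius_nonFundCount_sub_le_weak (Or.inr rfl) hneg hU
    refine ⟨K, fun ε hε => ?_⟩
    obtain ⟨C, hC⟩ := hK ε hε
    refine ⟨C + 4, fun X hX => ?_⟩
    have hX1 : (1 : ℝ) ≤ X := by exact_mod_cast hX
    obtain ⟨hsqrt, h1⟩ := sqrt_le_rpow_two_thirds hX1 hε.le
    have hW : ∑ D ∈ negFundDiscrs X, (cubicFieldCountOfDisc D : ℝ) =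
        (∑ q ∈ Finset.Icc 1 X, ((μ q : ℤ) : ℝ) * nonFundCount (-1) q X) - ((negFundDiscrs X).card : ℝ) / 2 := by
      rw [sum_moebius_mul_nonFundCount (Or.inr rfl), sum_locFund_shintaniCoeffReal_neg]; ring
    have hcard := abs_card_negFundDiscrs_sub_le X
    have hmain := hC X hX
    rw [hW]
    have key : (∑ q ∈ Finset.Icc 1 X, ((μ q : ℤ) : ℝ) * nonFundCount (-1) q X) - ((negFundDiscrs X).card : ℝ) / 2
        - 3 / (2 * Real.pi ^ 2) * X - K * (X : ℝ) ^ ((5 : ℝ) / 6) =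
        ((∑ q ∈ Finset.Icc 1 X, ((μ q : ℤ) : ℝ) * nonFundCount (-1) q X) - 3 / Real.pi ^ 2 * X - K * (X : ℝ) ^ ((5 : ℝ) / 6))
        - (((negFundDiscrs X).card : ℝ) - 3 / Real.pi ^ 2 * X) / 2 := by
      field_simp
      ring
    rw [key]
    calc |((∑ q ∈ Finset.Icc 1 X, ((μ q : ℤ) : ℝ) * nonFundCount (-1) q X) - 3 / Real.pi ^ 2 * X - K * (X : ℝ) ^ ((5 : ℝ) / 6))
          - (((negFundDiscrs X).card : ℝ) - 3 / Real.pi ^ 2 * X) / 2|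
        ≤ |(∑ q ∈ Finset.Icc 1 X, ((μ q : ℤ) : ℝ) * nonFundCount (-1) q X) - 3 / Real.pi ^ 2 * X - K * (X : ℝ) ^ ((5 : ℝ) / 6)|
          + |(((negFundDiscrs X).card : ℝ) - 3 / Real.pi ^ 2 * X) / 2| := abs_sub _ _
      _ ≤ C * (X : ℝ) ^ ((2 : ℝ) / 3 + ε) + 4 * Real.sqrt X := by
          refine add_le_add hmain ?_
          rw [abs_div, abs_two]
          linarith
      _ ≤ C * (X : ℝ) ^ ((2 : ℝ) / 3 + ε) + 4 * (X : ℝ) ^ ((2 : ℝ) / 3 + ε) := by linarith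
      _ = (C + 4) * (X : ℝ) ^ ((2 : ℝ) / 3 + ε) := by ring
  · obtain ⟨K, hK⟩ := abs_sum_moebius_nonFundCount_sub_le_weak (Or.inl rfl) hpos hU
    refine ⟨K, fun ε hε => ?_⟩
    obtain ⟨C, hC⟩ := hK ε hε
    refine ⟨C + 4 + shintaniCoeffReal 1, fun X hX => ?_⟩
    have hX1 : (1 : ℝ) ≤ X := by exact_mod_cast hX
    obtain ⟨hsqrt, h1⟩ := sqrt_le_rpow_two_thirds hX1 hε.le
    have ha1 : 0 ≤ shintaniCoeffReal 1 := shintaniCoeffReal_nonneg 1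
    have hW : ∑ D ∈ posFundDiscrs X, (cubicFieldCountOfDisc D : ℝ) =
        (∑ q ∈ Finset.Icc 1 X, ((μ q : ℤ) : ℝ) * nonFundCount 1 q X) - ((posFundDiscrs X).card : ℝ) / 2
          - (if 1 < X then shintaniCoeffReal 1 else 0) := by
      rw [sum_moebius_mul_nonFundCount (Or.inl rfl), sum_locFund_shintaniCoeffReal_pos]; ring
    have hcard := abs_card_posFundDiscrs_sub_le X
    have hmain := hC X hX
    have hextra : |(if 1 < X then shintaniCoeffReal 1 else 0)| ≤ shintaniCoeffReal 1 := by
      split_ifs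
      · exact (abs_of_nonneg ha1).le
      · rw [abs_zero]; exact ha1
    rw [hW]
    have key : (∑ q ∈ Finset.Icc 1 X, ((μ q : ℤ) : ℝ) * nonFundCount 1 q X) - ((posFundDiscrs X).card : ℝ) / 2
        - (if 1 < X then shintaniCoeffReal 1 else 0) - 1 / (2 * Real.pi ^ 2) * X - K * (X : ℝ) ^ ((5 : ℝ) / 6) =
        ((∑ q ∈ Finset.Icc 1 X, ((μ q : ℤ) : ℝ) * nonFundCount 1 q X) - 2 / Real.pi ^ 2 * X - K * (X : ℝ) ^ ((5 : ℝ) / 6))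
        - (((posFundDiscrs X).card : ℝ) - 3 / Real.pi ^ 2 * X) / 2 - (if 1 < X then shintaniCoeffReal 1 else 0) := by
      field_simp
      ring
    rw [key]
    calc |((∑ q ∈ Finset.Icc 1 X, ((μ q : ℤ) : ℝ) * nonFundCount 1 q X) - 2 / Real.pi ^ 2 * X - K * (X : ℝ) ^ ((5 : ℝ) / 6))
          - (((posFundDiscrs X).card : ℝ) - 3 / Real.pi ^ 2 * X) / 2 - (if 1 < X then shintaniCoeffReal 1 else 0)|
        ≤ |(∑ q ∈ Finset.Icc 1 X, ((μ q : ℤ) : ℝ) * nonFundCount 1 q X) - 2 / Real.pi ^ 2 * X - K * (X : ℝ) ^ ((5 : ℝ) / 6)|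
          + |(((posFundDiscrs X).card : ℝ) - 3 / Real.pi ^ 2 * X) / 2| + |(if 1 < X then shintaniCoeffReal 1 else 0)| :=
          (abs_sub _ _).trans (add_le_add (abs_sub _ _) le_rfl)
      _ ≤ C * (X : ℝ) ^ ((2 : ℝ) / 3 + ε) + 4 * Real.sqrt X + shintaniCoeffReal 1 := by
          refine add_le_add (add_le_add hmain ?_) hextra
          rw [abs_div, abs_two]
          linarith
      _ ≤ C * (X : ℝ) ^ ((2 : ℝ) / 3 + ε) + 4 * (X : ℝ) ^ ((2 : ℝ) / 3 + ε) + shintaniCoeffReal 1 * (X : ℝ) ^ ((2 : ℝ) / 3 + ε) := by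
          nlinarith
      _ = (C + 4 + shintaniCoeffReal 1) * (X : ℝ) ^ ((2 : ℝ) / 3 + ε) := by ring

/-- … and BTT Thm 1.2 (`btt_threeTorsion_sum`) with the class-field-theory dictionary. [cite: BhargavaTaniguchiThorne2023, §5 ((3) ⟺ Thm 1.2)] -/
theorem btt_threeTorsion_sum_of_landauShintaniWeak (hdict : threeTorsion_eq_two_mul_cubicFieldCountOfDisc_add_one)
    (hneg : LandauShintaniDataWeak (-1) (3 / Real.pi ^ 2)) (hpos : LandauShintaniDataWeak 1 (2 / Real.pi ^ 2))
    (hU : btt_uniformity_sqDvd) : btt_threeTorsion_sum :=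
  btt_threeTorsion_sum_holds_of hdict (btt_fundCubicFieldCount_sum_of_landauShintaniWeak hneg hpos hU)

end Literature.NumberTheory.CubicFields

end
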